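import Mathlib
import HarnessLib
import Summits.Parity.Statement
import Summits.Parity.GeneralizedHardyLittlewood.Theses.ExceptionalWindows

/-!
# Assembly of route-Parity-ExceptionalWindows (item stmt-Parity-24713)

`Assembly : NoUnboundedSiegelZeros → SiegelFreeNoExcess → SiegelFreeNoDeficit → GeneralizedHardyLittlewood` is literally the route's certified deciding theorem `closes`
(lens-4 g1 node «ExceptionalWindows» (rev 1)): no unbounded Siegel zeros + the two Siegel-free one-sided window statements.  One line; no mathematics beyond the route file.
-/

namespace Summit.Parity.GeneralizedHardyLittlewood.Theses.ExceptionalWindows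

/-- Assembly item stmt-Parity-24713 of route-Parity-ExceptionalWindows:
`NoUnboundedSiegelZeros → SiegelFreeNoExcess → SiegelFreeNoDeficit → GeneralizedHardyLittlewood`,
by the route's deciding theorem `closes`. -/
theorem assembly_proof : Assembly :=
  fun h1 h2 h3 => closes h1 h2 h3

end Summit.Parity.GeneralizedHardyLittlewood.Theses.ExceptionalWindows
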